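import Mathlib
import Summits.NavierStokesRegularity.NavierStokesRegularity.Theorems.ThreadingFluxHorizonTowerQuadraticGeneratorOcticBrackets
import HarnessLib

/-!
# Crux `PoloidalLiouville` (stmt-NavierStokesRegularity-1222), crux idea «horizon-threading-tower» (ns-idea-15):
# THE QUADRATIC GENERATOR, VII — the mixed quartic `π₄(LM)` and the span `⟨π₄(L²), π₄(LM)⟩` (toward the tower `{4, 6, 8}`)

Support file (`--supports stmt-NavierStokesRegularity-1222`, helper; cell `ns-wall-extremal`, width hand ns-wall-eng-3 g5; 0 kit), toward
THM G «the finite tower `{4, 6, 8}` is coaxially zonal at order one».  In that tower the top shells are `c₁·π₆(L³)`, `c₂·π₈(L⁴)` for the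
quadratic generator `L`, and the THIRD shell `P₄ ∈ 𝓗₄` is free; the second digit of the class identity confines it to the plane
spanned by `A = 35·π₄(L²)` and the MIXED quartic `A′ = 35·π₄(LM) = 35 LM − 15 τρL − 14 δρ²` (`M = |Qx|²`).

* `genAp` (`A′`): harmonic, homogeneous of degree 4, coefficient maps, scaling `A′(w•Q) = w³ A′(Q)`;
* brackets `{P, A′}`, `{L, A′} = 140 LW`, `{M, A′} = −140 MW + 60 τρW`, `{A′, B}`, `{A′, C}`, `{A, C}`;
* ★ `classIdentity468_span`: the closed form of `975 c₁c₂ {B, C} + 26 c₂ ρ {κA − 9c₁A′, C} + 11 c₁ ρ² {κA − 9c₁A′, B}` — it is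
  `ρ² W (L²(k_M M + k_L L) + ρ·REST)` with `k_M = −285405120 c₁c₂`: NO `ρ¹` digit, and the `ρ²` digit is LINEAR in `M` over `L²`;
* ★ (over `ℂ`) `exists_eq_C_mul_genA_of_chartT_detP_genL`: a solid harmonic `X ∈ 𝓗₄` whose bracket with `L ≠ 0` dies on the null cone is
  a multiple of `A` (weighted Wronskian `4xℓ′ = 2ℓx′ ⇒ x = γℓ²` + chart injectivity);
* ★ the class identity of the tower `{4, 6, 8}` (`N = 14`): `15{P₆,P₈} + 26ρ{P₄,P₈} + 11ρ²{P₄,P₆} = 0`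
  (`finiteTower_classIdentity_fourSixEight`) and its expansion for a general `P₄` (`Zonal.classIdentity468_expand`).

HONEST LABEL: polynomial identities about one crux idea's typed objects; no Prop of the sketch is closed here; `HorizonTowerZonality`
(general towers), `PoloidalLiouville` (1222) OPEN; NS regularity NOT proved.  [folklore]
-/

-- the summit and its single sub-problem share the name (CONVENTIONS §1)
set_option linter.dupNamespace false

noncomputable section

open MvPolynomial Complex
open scoped Polynomial

namespace Summit.NavierStokesRegularity.NavierStokesRegularity.Theorems.PoloidalLiouville.HorizonTower.Zonal

section Generic

variable {R : Type*} [CommRing R] (a b d e f : R)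

/-- `A′ = 35·π₄(LM) = 35 LM − 15 τρL − 14 δρ²`, the harmonic projection of the mixed quartic `L·M`. -/
def genAp : MvPolynomial (Fin 3) R :=
  C 35 * genL a b d e f * genM a b d e f - C (15 * genTau a b d e f) * normSq * genL a b d e f
    - C (14 * genDelta a b d e f) * normSq ^ 2

/-- ★ `A′` is harmonic. [folklore] -/
theorem lapP_genAp : lapP (genAp a b d e f) = 0 := by
  unfold genAp
  simp only [pow_succ, pow_zero, one_mul, lapP_sub, lapP_mul, lapP_C', lapP_genL, lapP_genM, lapP_normSq, dotP_mul_left,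
    dotP_mul_right, dotP_C_left, dotP_genL_genM, dotP_normSq_genL, dotP_normSq_normSq, mul_zero, add_zero, zero_add]
  simp only [map_ofNat, map_mul]
  ring

/-- `A′` is homogeneous of degree four. [folklore] -/
theorem isHomogeneous_genAp : (genAp a b d e f).IsHomogeneous 4 := by
  have hL := isHomogeneous_genL a b d e f
  have hM := isHomogeneous_genM a b d e f
  have hρ : (normSq : MvPolynomial (Fin 3) R).IsHomogeneous 2 := isHomogeneous_normSq
  have h1 : (C 35 * genL a b d e f * genM a b d e f : MvPolynomial (Fin 3) R).IsHomogeneous 4 := by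
    rw [mul_assoc]; exact (hL.mul hM).C_mul _
  have h2 : (C (15 * genTau a b d e f) * normSq * genL a b d e f : MvPolynomial (Fin 3) R).IsHomogeneous 4 := by
    rw [mul_assoc]; exact (hρ.mul hL).C_mul _
  have h3 : (C (14 * genDelta a b d e f) * normSq ^ 2 : MvPolynomial (Fin 3) R).IsHomogeneous 4 := (hρ.pow 2).C_mul _
  unfold genAp
  exact (h1.sub h2).sub h3

variable {S : Type*} [CommRing S] (φ : R →+* S)

/-- `A′` commutes with coefficient maps. [folklore] -/
theorem map_genAp : map φ (genAp a b d e f) = genAp (φ a) (φ b) (φ d) (φ e) (φ f) := by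
  simp only [genAp, genL, genM, genQ0, genQ1, genQ2, genTau, genDelta, normSq, map_add, map_sub, map_mul, map_pow, map_neg,
    map_X, map_C, map_ofNat]

/-- `A′(w•Q) = w³ A′(Q)`. [folklore] -/
theorem genAp_smul (w : R) : genAp (w * a) (w * b) (w * d) (w * e) (w * f) = C (w ^ 3) * genAp a b d e f := by
  simp only [genAp, genL, genM, genQ0, genQ1, genQ2, genTau, genDelta, map_mul, map_add, map_pow, map_sub, map_neg,
    map_ofNat]
  ring

end Generic

/-! ### Brackets (real coefficients) -/

section Real

variable (a b d e f : ℝ)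

/-- `{P, A′} = 35 (L{P,M} + M{P,L}) − 15 τρ {P,L}`. [folklore] -/
theorem detP_genAp_right (P : RPoly) : detP P (genAp a b d e f)
    = C 35 * (genL a b d e f * detP P (genM a b d e f) + genM a b d e f * detP P (genL a b d e f))
      - C (15 * genTau a b d e f) * normSq * detP P (genL a b d e f) := by
  unfold genAp
  simp only [detP_sub_right, detP_mul_right, detP_normSq_right, detP_C_right, pow_succ, pow_zero, one_mul, mul_zero, add_zero]
  simp only [map_ofNat, map_mul]
  ring

/-- `{L, A′} = 140 L W`. [folklore] -/
theorem detP_genL_genAp : detP (genL a b d e f) (genAp a b d e f) = C 140 * genL a b d e f * genW a b d e f := by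
  rw [detP_genAp_right, detP_self, detP_genL_genM]; simp only [map_ofNat, map_mul]; ring

/-- `{M, A′} = −140 M W + 60 τρ W`. [folklore] -/
theorem detP_genM_genAp : detP (genM a b d e f) (genAp a b d e f)
    = -(C 140 * genM a b d e f * genW a b d e f) + C (60 * genTau a b d e f) * normSq * genW a b d e f := by
  rw [detP_genAp_right, detP_self, detP_genM_genL]; simp only [map_ofNat, map_mul]; ring

/-- `{A′, B} = W (−32340 L³ + 3080 τρ²L)`. [folklore] -/
theorem detP_genAp_genB : detP (genAp a b d e f) (genB a b d e f)
    = genW a b d e f * (-(C 32340 * genL a b d e f ^ 3) + C (3080 * genTau a b d e f) * normSq ^ 2 * genL a b d e f) := by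
  have hL := detP_genL_genB a b d e f
  have hM := detP_genM_genB a b d e f
  unfold genAp
  simp only [detP_sub_left, detP_mul_left, detP_normSq_left, detP_C_left, hL, hM, pow_succ, pow_zero, one_mul, mul_zero,
    add_zero]
  simp only [map_ofNat, map_mul]
  ring

/-- `{A′, C} = W (−1201200 L⁴ + 480480 ρL²M + 147840 ρ²M² + 21120 τρ²L² − 83520 τρ³M − 107520 δρ³L + 8640 τ²ρ⁴)`. [folklore] -/
theorem detP_genAp_genC : detP (genAp a b d e f) (genC a b d e f)
    = genW a b d e f * (-(C 1201200 * genL a b d e f ^ 4) + C 480480 * normSq * genL a b d e f ^ 2 * genM a b d e f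
      + C 147840 * normSq ^ 2 * genM a b d e f ^ 2 + C (21120 * genTau a b d e f) * normSq ^ 2 * genL a b d e f ^ 2
      - C (83520 * genTau a b d e f) * normSq ^ 3 * genM a b d e f - C (107520 * genDelta a b d e f) * normSq ^ 3 * genL a b d e f
      + C (8640 * genTau a b d e f ^ 2) * normSq ^ 4) := by
  have hL := detP_genL_genC a b d e f
  have hM := detP_genM_genC a b d e f
  unfold genAp
  simp only [detP_sub_left, detP_mul_left, detP_normSq_left, detP_C_left, hL, hM, pow_succ, pow_zero, one_mul, mul_zero,
    add_zero]
  simp only [map_ofNat, map_mul]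
  ring

/-- `{A, C} = W (−274560 ρL³ − 253440 ρ²LM + 65280 τρ³L + 61440 δρ⁴)`. [folklore] -/
theorem detP_genA_genC : detP (genA a b d e f) (genC a b d e f)
    = genW a b d e f * (-(C 274560 * normSq * genL a b d e f ^ 3) - C 253440 * normSq ^ 2 * genL a b d e f * genM a b d e f
      + C (65280 * genTau a b d e f) * normSq ^ 3 * genL a b d e f + C (61440 * genDelta a b d e f) * normSq ^ 4) := by
  have hL := detP_genL_genC a b d e f
  have hM := detP_genM_genC a b d e f
  unfold genA
  simp only [detP_add_left, detP_sub_left, detP_mul_left, detP_normSq_left, detP_C_left, hL, hM, pow_succ, pow_zero,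
    one_mul, mul_zero, add_zero]
  simp only [map_ofNat, map_mul]
  ring

/-- ★ **CLOSED FORM OF THE `{4, 6, 8}` CLASS IDENTITY ON THE SPAN `⟨A, A′⟩`** (scaled by `65`): for `65·P₄ = κA − 9c₁A′`,
`P₆ = c₁B`, `P₈ = c₂C`, the polynomial `975c₁c₂{B,C} + 26c₂ρ{κA − 9c₁A′, C} + 11c₁ρ²{κA − 9c₁A′, B}` equals `W` times an explicit
polynomial with NO `ρ¹` term, whose `ρ²` term is `L²(−285405120 c₁c₂ M + (−7138560 c₂κ + 3201660 c₁²) L)`. [folklore] -/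
theorem classIdentity468_span (κ c₁ c₂ : ℝ) :
    C (975 * c₁ * c₂) * detP (genB a b d e f) (genC a b d e f)
      + C (26 * c₂) * normSq * detP (C κ * genA a b d e f - C (9 * c₁) * genAp a b d e f) (genC a b d e f)
      + C (11 * c₁) * normSq ^ 2 * detP (C κ * genA a b d e f - C (9 * c₁) * genAp a b d e f) (genB a b d e f)
    = normSq ^ 2 * genW a b d e f * (genL a b d e f ^ 2 * (C ((-285405120) * c₁ * c₂) * genM a b d e f + C ((-7138560) * c₂ * κ + (3201660) * c₁ ^ 2) * genL a b d e f)
        + normSq * (C ((-380540160) * c₁ * c₂) * genM a b d e f ^ 2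
          + C ((-6589440) * c₂ * κ) * genL a b d e f * genM a b d e f
          + C ((-55440) * c₁ * κ) * genL a b d e f ^ 2
          + C (((110373120) * c₁ * c₂) * genTau a b d e f) * genL a b d e f ^ 2
          + C ((-73920) * c₁ * κ) * normSq * genM a b d e f
          + C (((124375680) * c₁ * c₂) * genTau a b d e f) * normSq * genM a b d e f
          + C (((276756480) * c₁ * c₂) * genDelta a b d e f) * normSq * genL a b d e f
          + C (((1697280) * c₂ * κ + (-304920) * c₁ ^ 2) * genTau a b d e f) * normSq * genL a b d e f
          + C (((1597440) * c₂ * κ) * genDelta a b d e f) * normSq ^ 2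
          + C (((12320) * c₁ * κ) * genTau a b d e f) * normSq ^ 2
          + C (((-9884160) * c₁ * c₂) * genTau a b d e f ^ 2) * normSq ^ 2)) := by
  simp only [detP_sub_left, detP_C_mul_left, detP_genB_genC, detP_genA_genC, detP_genAp_genC, detP_genA_genB, detP_genAp_genB]
  simp only [map_ofNat, map_mul, map_add, map_neg, map_pow]
  ring

end Real

/-! ### The structure lemma on the null cone (complex coefficients) -/

/-- ★ **A quartic solid harmonic whose bracket with the generator dies on the null cone is a multiple of `A`.** [folklore] -/
theorem exists_eq_C_mul_genA_of_chartT_detP_genL {a b d e f : ℂ} {X : MvPolynomial (Fin 3) ℂ} (hX : X.IsHomogeneous 4)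
    (hlap : lapP X = 0) (hL : genL a b d e f ≠ 0) (h : chartT (detP X (genL a b d e f)) = 0) :
    ∃ γ : ℂ, X = C γ * genA a b d e f := by
  set x : ℂ[X] := chartT X with hx
  set ℓ : ℂ[X] := chartT (genL a b d e f) with hℓ
  have hℓ0 : ℓ ≠ 0 := fun h0 => hL (eq_zero_of_chartT_eq_zero (isHomogeneous_genL a b d e f) (lapP_genL a b d e f) (hℓ ▸ h0))
  -- weighted Wronskian law `4 x ℓ′ = 2 ℓ x′`
  have hW := chartT_detP hX (isHomogeneous_genL a b d e f)
  rw [h, mul_zero, ← hx, ← hℓ] at hW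
  have hW' : (4 : ℂ[X]) * x * Polynomial.derivative ℓ = (2 : ℂ[X]) * ℓ * Polynomial.derivative x := by
    have := sub_eq_zero.mp hW.symm
    exact_mod_cast this
  have hWr := wronskian_pow_pow_eq_zero (a := 4) (b := 2) (by norm_num) (by norm_num) hW'
  obtain ⟨c, hc⟩ := exists_C_mul_of_wronskian_eq_zero (pow_ne_zero _ hℓ0) hWr
  have hx2 : x ^ 2 = Polynomial.C c * (ℓ ^ 2) ^ 2 := by rw [hc]; ring
  obtain ⟨γ, hγ⟩ := exists_eq_C_mul_pow_of_pow_eq (D := 2) (d := 2) (by norm_num) hℓ0 hx2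
  exact ⟨γ / 35, eq_C_mul_genA_of_chartT_eq a b d e f hX hlap (hx ▸ hγ)⟩

end Summit.NavierStokesRegularity.NavierStokesRegularity.Theorems.PoloidalLiouville.HorizonTower.Zonal

namespace Summit.NavierStokesRegularity.NavierStokesRegularity.Theorems.PoloidalLiouville.HorizonTower

open scoped RealInnerProductSpace

/-! ### The class identity of the tower `{4, 6, 8}` and its expansion -/

/-- ★ **THE CLASS IDENTITY OF THE TOWER `{4, 6, 8}`**: `15 {P₆, P₈} + 26 ρ {P₄, P₈} + 11 ρ² {P₄, P₆} = 0`. [folklore] -/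
theorem finiteTower_classIdentity_fourSixEight (H : ℕ → E3 → ℝ)
    (hH : ∀ l ∈ ({4, 6, 8} : Finset ℕ), ContDiff ℝ (⊤ : ℕ∞) (H l))
    (hhom : ∀ l ∈ ({4, 6, 8} : Finset ℕ), ∀ (c : ℝ) (y : E3), H l (c • y) = c ^ l * H l y)
    (hharm : ∀ l ∈ ({4, 6, 8} : Finset ℕ), ∀ y, Laplacian.laplacian (H l) y = 0)
    (hL1 : ∀ x : E3, x ≠ 0 → horizonL1 (fun z => ∑ l ∈ ({4, 6, 8} : Finset ℕ), horizonProfile l (H l) 0 z) 0 x = 0)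
    (P : ℕ → MvPolynomial (Fin 3) ℝ) (hP : ∀ l ∈ ({4, 6, 8} : Finset ℕ), ∀ y, H l y = Zonal.evalE (P l) y) :
    C 15 * Zonal.detP (P 6) (P 8) + C 26 * Zonal.normSq * Zonal.detP (P 4) (P 8)
      + C 11 * Zonal.normSq ^ 2 * Zonal.detP (P 4) (P 6) = 0 := by
  classical
  have hK : ∀ l ∈ ({4, 6, 8} : Finset ℕ), 1 ≤ l := by
    intro l hl
    simp only [Finset.mem_insert, Finset.mem_singleton] at hl
    omega
  have h := finiteTower_classPoly_eq_zero {4, 6, 8} H hK hH hhom hharm hL1 P hP 14 (by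
    intro j hj k hk hjk
    simp only [Finset.mem_insert, Finset.mem_singleton] at hj hk
    rcases hj with rfl | rfl | rfl <;> rcases hk with rfl | rfl | rfl <;> first | omega | exact Zonal.detP_self' _)
  have h46 : (4 : ℕ) ∉ ({6, 8} : Finset ℕ) := by decide
  have h68 : (6 : ℕ) ∉ ({8} : Finset ℕ) := by decide
  simp only [Finset.sum_insert h46, Finset.sum_insert h68, Finset.sum_singleton] at h
  norm_num at h
  rw [Zonal.detP_antisymm (P 4) (P 6), Zonal.detP_antisymm (P 4) (P 8), Zonal.detP_antisymm (P 6) (P 8)] at h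
  have h4 : (C (-4 : ℝ) : MvPolynomial (Fin 3) ℝ) ≠ 0 := by rw [Ne, C_eq_zero]; norm_num
  have key : C (-4 : ℝ) * (C 15 * Zonal.detP (P 6) (P 8) + C 26 * Zonal.normSq * Zonal.detP (P 4) (P 8)
      + C 11 * Zonal.normSq ^ 2 * Zonal.detP (P 4) (P 6)) = 0 := by
    rw [← h, Zonal.normSq]
    simp only [map_neg, map_ofNat]
    ring
  exact (mul_eq_zero.mp key).resolve_left h4

namespace Zonal

/-- ★ **EXPANSION OF THE `{4, 6, 8}` CLASS IDENTITY for a general `P₄`** (`u = {P₄, L}`, `v = {P₄, M}`): one factor `ρ`, then the digit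
`223080 c₂ L³ u − 4324320 c₁c₂ L⁴ W`, then a multiple of `ρ`. [folklore] -/
theorem classIdentity468_expand (a b d e f : ℝ) (P : RPoly) (c₁ c₂ : ℝ) :
    C 15 * detP (C c₁ * genB a b d e f) (C c₂ * genC a b d e f) + C 26 * normSq * detP P (C c₂ * genC a b d e f)
      + C 11 * normSq ^ 2 * detP P (C c₁ * genB a b d e f)
    = normSq * ((C (223080 * c₂) * genL a b d e f ^ 3 * detP P (genL a b d e f)
        - C (4324320 * c₁ * c₂) * genL a b d e f ^ 4 * genW a b d e f)
      + normSq * (C (15 * c₁ * c₂) * genW a b d e f * (-(C 177408 * genL a b d e f ^ 2 * genM a b d e f)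
          - C 354816 * normSq * genM a b d e f ^ 2 + C (118272 * genTau a b d e f) * normSq * genL a b d e f ^ 2
          + C (107520 * genTau a b d e f) * normSq ^ 2 * genM a b d e f
          + C (258048 * genDelta a b d e f) * normSq ^ 2 * genL a b d e f - C (8064 * genTau a b d e f ^ 2) * normSq ^ 3)
        + C (26 * c₂) * ((-(C 6864 * genL a b d e f * genM a b d e f) + C (1320 * genTau a b d e f) * normSq * genL a b d e f
            + C (768 * genDelta a b d e f) * normSq ^ 2) * detP P (genL a b d e f)
          + (-(C 3432 * genL a b d e f ^ 2) + C 1056 * normSq * genM a b d e f - C (144 * genTau a b d e f) * normSq ^ 2)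
            * detP P (genM a b d e f))
        + C (11 * c₁) * (C 231 * genL a b d e f ^ 2 * detP P (genL a b d e f)
          - C 84 * normSq * (genL a b d e f * detP P (genM a b d e f) + genM a b d e f * detP P (genL a b d e f))
          + C (14 * genTau a b d e f) * normSq ^ 2 * detP P (genL a b d e f)))) := by
  rw [show detP (C c₁ * genB a b d e f) (C c₂ * genC a b d e f) = C c₁ * (C c₂ * detP (genB a b d e f) (genC a b d e f))
    by rw [detP_C_mul_left, detP_C_mul_right], detP_genB_genC]
  simp only [detP_C_mul_right, detP_genB_right, detP_genC_right]
  simp only [map_ofNat, map_mul]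
  ring

end Zonal


end Summit.NavierStokesRegularity.NavierStokesRegularity.Theorems.PoloidalLiouville.HorizonTower

end
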